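import Summits.ABC.ABC.Theses.CubicResolventAllowance
import Summits.ABC.ABC.Theorems.CubicResolventAllowanceResolventDiscBounds
import Literature.NumberTheory.EllipticCurves.RationalIsogenyDegrees
import Literature.NumberTheory.EllipticCurves.PastenValuationProductMestreOesterleProofs
import HarnessLib

/-!
# STUB-IDEAS `stub_realCubic` · ideator k3 · generation 11 — AUTOPSY OF THE PROVED RUNG (the lone-tower extreme)

Crux stmt-ABC-22740 `CubicResolventAllowance.IndexSzpiro`, stub `stub_realCubic`, route-ABC-CubicResolventAllowance.
HOME FAMILY 3 (probe the extremes), gen 11.  The ten earlier k3 pages probed the extremes of the STUB; this one probes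
the extreme of the one PROVED rung (BC5: prime conductor, Mestre–Oesterlé `n_p ≤ 5`, k1 G3 / k3 G5b) by taking its
mechanism apart on the stub's class (`ψ₂` irreducible) and pushing the cofactor `M = N/p` up from `1`:

* PARITY (H1 = k3 G8 H6, + H1′ = k3 G10 R3b, both tree-closable): at a lone odd multiplicative prime the tower is
  ODD — `N = 2^k·p ⇒ n_p odd` (H2, PROVED here modulo H1, H1′).  Minkowski forces an odd ramified prime of `K`,
  NOS puts it in `N`, so it is `p`; Tate at level 2 gives `v_p(d_K) ≤ 1` and the keystone `2⁸Δ_min = I²d_K` gives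
  `v_p(d_K) ≡ n_p (2)`.
* LEVEL-LOWERING (H4, literature): an odd prime `ℓ ∣ n_p` with `ρ̄_{E,ℓ}` irreducible lowers `f_E` to
  `S₂(Γ₀(2^k)) = 0` for `k ≤ 4` — so `ρ̄_{E,ℓ}` is reducible: a rational `ℓ`-isogeny.
* ISOGENY ⇒ SIZE (H5, Bennett–Yazdani 2012 Thm 1.3, `M = 2^k`): `n_p ≤ 6` for `p ≥ C(2^k)`.
Hence `R(2^k·p)`, `k ≤ 4`: `n_p ∈ {1,3,5}` for `p ≥ p₀(k)` — `LocalIndexSzpiroAt (2^k) 5` (H6, PROVED modulo H1,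
H1′, H4, H5); `k = 0` is the BC5 rung in local currency (H7, PROVED from the vendored fact).  General cofactor
(§1b, schema H2′ + census j345203): the parity organ survives exactly when the finite set `𝒦(M)` of cubic fields
with `|d_K| ∣ A(M)` (allowance table, tame-sharpened) is empty — true for every genus-0 `M` on the real class — so
the rung's habitat is `{N = M·p : S₂(Γ₀(M)) = 0}`; it dies at `M = 11` (`11a` spans `S₂(Γ₀(11))` AND `ℚ(11a[2])`
is the one field of `𝒦(11)`), at `M = 32` (`32a`), and at `27 ∣ M` (`ℚ(∛2)`, `ℚ(ζ₉)⁺`: k3 G5's Thue–Mahler depth,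
open).  The rung is LOCAL: at `N = 2p` the stub is a bound on
the OTHER tower, `2^{n_2} ≤ C·p^{κ}` (H8): `κ = 2+ε` suffices, `κ = 6+ε` is necessary, `κ = 8+ε` follows from the
stub (H8b, PROVED), and the known ceiling is `n_2 ≪ p log p` (tree-named `pasten_thm_7_5_explicit`).  Verdict of
gens 0–10 (`open-problem`) stands; the smallest open instance of the stub is the one-parameter family `N = 2p`.
Sorries: none in the glue; H9 (M) is the only `sorry` (inputs named).
-/

noncomputable section

open scoped NumberField
open NumberField Polynomial WeierstrassCurve

namespace Summit.ABC.ABC.Cruxes.IndexSzpiro.StubIdeas3G11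

open Summit.ABC.ABC.Theses.CubicResolventAllowance Summit.ABC.ABC.Theorems
open Literature.NumberTheory.EllipticCurves

/-! ## §0 The stub (verbatim) and the local currency -/

/-- The registered stub `stub_realCubic`, verbatim. -/
def StubRealCubic : Prop :=
  ∀ ε : ℝ, 0 < ε → ∃ C : ℝ, ∀ (W : WeierstrassCurve ℚ) [W.IsElliptic] (K : Type) [Field K] [NumberField K],
    Irreducible W.twoTorsionPolynomial.toPoly → Module.finrank ℚ K = 3 →
    (∃ θ : K, aeval θ W.twoTorsionPolynomial.toPoly = 0) → 0 < NumberField.discr K →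
    (W.minimalDiscriminantNorm ℤ : ℝ) ≤ C * |(NumberField.discr K : ℝ)| * (W.conductorNorm ℤ : ℝ) ^ (6 + ε)

/-- **H0 (def).** `LocalIndexSzpiroAt M B`: for all large primes `p ∤ M`, every (real) class curve of conductor
`N = M·p` has `n_p = v_p(Δ_min) ≤ B`.  (k3 G5's `LocalIndexSzpiroMp B` is `∀ M > 0, LocalIndexSzpiroAt M B`;
Bennett–Yazdani 2012 Conj. 1.2: `B = 6` for all `E/ℚ`.) -/
def LocalIndexSzpiroAt (M B : ℕ) : Prop :=
  ∃ p₀ : ℕ, ∀ (W : WeierstrassCurve ℚ) [W.IsElliptic] (K : Type) [Field K] [NumberField K],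
    Irreducible W.twoTorsionPolynomial.toPoly → Module.finrank ℚ K = 3 →
    (∃ θ : K, aeval θ W.twoTorsionPolynomial.toPoly = 0) → 0 < NumberField.discr K →
    ∀ p : ℕ, p.Prime → p₀ ≤ p → ¬ p ∣ M → W.conductorNorm ℤ = M * p →
      (W.minimalDiscriminantNorm ℤ).factorization p ≤ B

/-! ## §1 The parity branch: a lone odd multiplicative tower is ODD -/

/-- **H1 (hypothesis; = k3 G8 H6 universally closed, via `Nat.factorization_def`; PROVED there modulo G8-H1
(cubic field, all `e ≤ 2` at odd `p` ⇒ `v_p(d_K) ≤ 1`, S/M), G8-H2 (Tate at level 2: `f_p = 1`, `p` odd ⇒ every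
prime of `K ↪ ℚ(E[2])` over `p` has `e ≤ 2`, S/M; tree
`ramificationIdx_divisionField_self_dvd_level_of_hasMultiplicativeReductionAt`) and the keystone `2⁸Δ_min = I²d_K`
(k1 G5 `K6`, PROVED)).**  At an odd prime `p ∥ N`: `v_p(d_K) = n_p mod 2`.
[cite: SilvermanATAEC1994, V.4–V.5 and Exercise 5.13 (b)] -/
def MultParityLaw : Prop :=
  ∀ (W : WeierstrassCurve ℚ) [W.IsElliptic] (K : Type) [Field K] [NumberField K],
    Irreducible W.twoTorsionPolynomial.toPoly → Module.finrank ℚ K = 3 →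
    (∃ θ : K, aeval θ W.twoTorsionPolynomial.toPoly = 0) →
    ∀ p : ℕ, p.Prime → p ≠ 2 → (W.conductorNorm ℤ).factorization p = 1 →
      (NumberField.discr K).natAbs.factorization p = (W.minimalDiscriminantNorm ℤ).factorization p % 2

/-- **H1′ (hypothesis; = k3 G10 R3b `exists_odd_prime_dvd_discr_dvd_conductor`, PROVED there — Minkowski
`|d_K| > 11 > 2³ ≥ 2^{v₂(d_K)}` (`NumberField.abs_discr_ge'`, tree `padicValNat_two_discr_le_three`) + NOS at
level 2 (`not_dvd_discr_divisionField_two`, `NumberField.discr_dvd_discr`); bank it in Theorems, the Cruxes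
module is not built).**  In the class some ODD prime divides both `d_K` and `N`. [cite: NeukirchANT1999, III (2.14)] -/
def OddPrimeMeetsConductor : Prop :=
  ∀ (W : WeierstrassCurve ℚ) [W.IsElliptic] (K : Type) [Field K] [NumberField K],
    Irreducible W.twoTorsionPolynomial.toPoly → Module.finrank ℚ K = 3 →
    (∃ θ : K, aeval θ W.twoTorsionPolynomial.toPoly = 0) →
    ∃ p : ℕ, p.Prime ∧ p ≠ 2 ∧ p ∣ (NumberField.discr K).natAbs ∧ p ∣ W.conductorNorm ℤ

/-- The only odd prime dividing `2^k·p` is `p`. -/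
theorem eq_of_prime_dvd_two_pow_mul {q p k : ℕ} (hq : q.Prime) (hq2 : q ≠ 2) (hp : p.Prime)
    (h : q ∣ 2 ^ k * p) : q = p := by
  have h2 : ¬ q ∣ 2 ^ k := fun h' =>
    hq2 ((Nat.prime_dvd_prime_iff_eq hq Nat.prime_two).mp (hq.dvd_of_dvd_pow h'))
  exact (Nat.prime_dvd_prime_iff_eq hq hp).mp ((hq.dvd_mul.mp h).resolve_left h2)

/-- `v_p(2^k·p) = 1` for an odd prime `p`. -/
theorem factorization_two_pow_mul_self {p k : ℕ} (hp : p.Prime) (hp2 : p ≠ 2) :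
    (2 ^ k * p).factorization p = 1 := by
  have h2 : (2 : ℕ).factorization p = 0 := by
    apply Nat.factorization_eq_zero_of_not_dvd
    intro h
    exact hp2 ((Nat.prime_dvd_prime_iff_eq hp Nat.prime_two).mp h)
  rw [Nat.factorization_mul (pow_ne_zero _ two_ne_zero) hp.ne_zero, Finsupp.add_apply,
    hp.factorization_self, Nat.factorization_pow, Finsupp.smul_apply, smul_eq_mul, h2, mul_zero, zero_add]

/-- **H2 (S, PROVED modulo H1, H1′) — the lone-tower parity lemma.**  A class curve of conductor `2^k·p`
(`p` odd; `k ≤ 8` automatically) has an ODD `p`-tower `n_p`.  Equivalently: an elliptic curve of conductor `2^k·p`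
with EVEN `v_p(Δ_min)` has a rational point of order 2 or a reducible `ψ₂` (Setzer–Neumann `Δ = -p²`, `17a`:
`Δ = -17⁴`, `52a1`: `Δ = -2⁸13²` all have rational 2-torsion).  Serves BOTH sign halves (no `0 < d_K` used). -/
theorem odd_factorization_of_conductorNorm_eq_two_pow_mul (hPL : MultParityLaw) (hOM : OddPrimeMeetsConductor)
    (W : WeierstrassCurve ℚ) [W.IsElliptic] (K : Type) [Field K] [NumberField K]
    (hirr : Irreducible W.twoTorsionPolynomial.toPoly) (hK : Module.finrank ℚ K = 3)
    (hθ : ∃ θ : K, aeval θ W.twoTorsionPolynomial.toPoly = 0)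
    {p k : ℕ} (hp : p.Prime) (hp2 : p ≠ 2) (hN : W.conductorNorm ℤ = 2 ^ k * p) :
    Odd ((W.minimalDiscriminantNorm ℤ).factorization p) := by
  obtain ⟨q, hq, hq2, hqd, hqN⟩ := hOM W K hirr hK hθ
  rw [hN] at hqN
  have hqp : q = p := eq_of_prime_dvd_two_pow_mul hq hq2 hp hqN
  rw [hqp] at hqd
  have hf : (W.conductorNorm ℤ).factorization p = 1 := by
    rw [hN]; exact factorization_two_pow_mul_self hp hp2
  have hpar := hPL W K hirr hK hθ p hp hp2 hf
  have hd0 : (NumberField.discr K).natAbs ≠ 0 := Int.natAbs_ne_zero.mpr (NumberField.discr_ne_zero K)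
  have hpos : 0 < (NumberField.discr K).natAbs.factorization p := hp.factorization_pos_of_dvd hd0 hqd
  rw [Nat.odd_iff]
  omega

/-! ## §1b The parity branch at a general cofactor `M` (schema; data: kit jobs j345195, j345203) -/

/-- No cubic number field has `|d_K| ∣ A`.  `A = 8`: k3 G10 R3a (Minkowski), PROVED.  `A ∈ {24, 40, 56, 120, 168, …}`:
TRUE (PARI 2.17 `nflist("S3"/"C3")`, job j345203 lists the cubic fields with `|d_K| ∣ A(M)` for every `M ≤ 60`),
Lean-provable only through a cubic-field enumeration below the bound (M-sized: Hermite/Davenport reduction). -/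
def NoCubicFieldDvd (A : ℕ) : Prop :=
  ∀ (K : Type) [Field K] [NumberField K], Module.finrank ℚ K = 3 → ¬ (NumberField.discr K).natAbs ∣ A

/-- **Even-tower allowance at cofactor `M` (hypothesis-schema; = k3 G8 H1–H3 / k2 g9 B2–B3 allowance table, sharpened
by TAMENESS: `f_q(E) = 2 ⇒` the wild inertia at `q` acts trivially on `E[2]` (Swan conductor read on `E[2]`, `q ≠ 2`)
`⇒ e_q(K) ∣ #(tame cyclic image) ∈ {1,2}`, so `v₃(d_K) ≤ 1` unless `27 ∣ N` — census: `v₃(d_K) ∈ {0,1,3,4,5}`, never 2).**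
If `N = M·p` (`p` odd, `p ∤ M`) and `n_p` is EVEN then `p ∤ d_K` (H1), every odd prime of `d_K` divides `M` (NOS), and
`|d_K| ∣ A(M) := 8 · ∏_{q ∥ M, q odd} q · ∏_{q² ∣ M, q ≥ 5} q² · 3^{c₃}`, `c₃ = 0, 1, 1, 5` for `v₃(M) = 0, 1, 2, ≥ 3`. -/
def EvenTowerAllowance (M A : ℕ) : Prop :=
  ∀ (W : WeierstrassCurve ℚ) [W.IsElliptic] (K : Type) [Field K] [NumberField K],
    Irreducible W.twoTorsionPolynomial.toPoly → Module.finrank ℚ K = 3 →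
    (∃ θ : K, aeval θ W.twoTorsionPolynomial.toPoly = 0) →
    ∀ p : ℕ, p.Prime → p ≠ 2 → ¬ p ∣ M → W.conductorNorm ℤ = M * p →
      Even ((W.minimalDiscriminantNorm ℤ).factorization p) → (NumberField.discr K).natAbs ∣ A

/-- **H2′ (S, PROVED — the parity branch at cofactor `M`, trivial glue).**  `EvenTowerAllowance M A ∧ NoCubicFieldDvd A ⇒`
every class curve of conductor `M·p` has an odd `p`-tower.  Job j345203: `NoCubicFieldDvd (A M)` holds for
`M ∈ {1,…,10, 12, 14, 15, 16, 17, 18, 20, 21, 24, 28, 30, 32, …}` (with the tame `c₃`), and fails exactly through tiny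
resolvent fields — `M = 11: K₋₄₄` (the 2-division field of `11a`), `13: K₋₁₀₄`, `19: K₋₇₆, K₋₁₅₂`, `23: K₋₂₃`,
`25: K₋₂₀₀`, `27: ℚ(∛2), …` — and the box census (j345203: 96 279 even towers among 1 920 604 odd multiplicative
towers of 840 131 class curves) finds even towers at `N = M·p`, `M ≤ 60`, ONLY on those fields (0 exceptions). -/
theorem odd_factorization_of_noCubicFieldDvd {M A : ℕ} (hA : EvenTowerAllowance M A) (hno : NoCubicFieldDvd A)
    (W : WeierstrassCurve ℚ) [W.IsElliptic] (K : Type) [Field K] [NumberField K]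
    (hirr : Irreducible W.twoTorsionPolynomial.toPoly) (hK : Module.finrank ℚ K = 3)
    (hθ : ∃ θ : K, aeval θ W.twoTorsionPolynomial.toPoly = 0)
    {p : ℕ} (hp : p.Prime) (hp2 : p ≠ 2) (hpM : ¬ p ∣ M) (hN : W.conductorNorm ℤ = M * p) :
    Odd ((W.minimalDiscriminantNorm ℤ).factorization p) := by
  rcases Nat.even_or_odd ((W.minimalDiscriminantNorm ℤ).factorization p) with h | h
  · exact absurd (hA W K hirr hK hθ p hp hp2 hpM hN h) (hno K hK)
  · exact h

/-! ## §2 The Ribet branch and the isogeny ⇒ size conversion (named literature inputs) -/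

/-- `W` admits a `ℚ`-rational isogeny of degree `n` onto some elliptic curve over `ℚ` (tree `WeierstrassCurve.Isogeny`,
`Isogeny.degree = #ker` in characteristic 0). -/
def HasRationalIsogenyOfDegree (W : WeierstrassCurve ℚ) (n : ℕ) : Prop :=
  ∃ (W' : WeierstrassCurve ℚ) (φ : WeierstrassCurve.Isogeny W W'), W'.IsElliptic ∧ φ.degree = n

/-- **H4 `RibetLevelLoweringTwoPower` (named literature input; NOT in the tree — no level-lowering decl exists).**
`N = 2^k·p`, `k ≤ 4`, `p` odd, `ℓ` an odd prime with `ℓ ∣ n_p` ⇒ `E` has a rational `ℓ`-isogeny.  Composition: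
modularity (BCDT); `p ∥ N` and `ℓ ∣ v_p(Δ_min)` ⇒ `ρ̄_{E,ℓ}` unramified at `p` (`p ≠ ℓ`, Tate) resp. finite at `p`
(`p = ℓ`) [B–Y p. 15]; if `ρ̄_{E,ℓ}` were irreducible (absolutely, `ℓ` odd), Ribet's theorem gives a weight-2
newform of level dividing `2^k ≤ 16` — none (`X₀(1), X₀(2), X₀(4), X₀(8), X₀(16)` have genus 0); so `ρ̄_{E,ℓ}` is
reducible, i.e. `E[ℓ]` has a rational line, i.e. a rational `ℓ`-isogeny.  Presearch: no statement of this
composite for conductor `2^k p` found (corpus fts/hybrid/vsearch "conductor 2p level lowering isogeny"; galaxy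
"conductor 2p|conducteur 2p"); nearest in print: B–Y §6–§7 (p. 15–16) use exactly this lowering at `N = Mp`.
[cite: Ribet1990, Thm. 1.1] [cite: paper:doi-10-1080-10586458-2012-645780, §6 (p. 15–16)] -/
def RibetLevelLoweringTwoPower : Prop :=
  ∀ (W : WeierstrassCurve ℚ) [W.IsElliptic] (k p ℓ : ℕ), k ≤ 4 → p.Prime → p ≠ 2 → ℓ.Prime → ℓ ≠ 2 →
    W.conductorNorm ℤ = 2 ^ k * p → ℓ ∣ (W.minimalDiscriminantNorm ℤ).factorization p →
    HasRationalIsogenyOfDegree W ℓ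

/-- **H5 `BennettYazdaniTwoPower` (named literature FACT, Bennett–Yazdani, Exp. Math. 21 (2012), Thm 1.3 with
`M = 2^k`):** "Let `E/ℚ` have conductor `N(E) = Mp` … Assume that there is an integer `n > 1` such that `E` possesses
a rational `n`-isogeny. Then there exists a constant `C = C(M)` such that if `p ≥ C` then `v_p(Δ(E)) ≤ 6`."
[cite: paper:doi-10-1080-10586458-2012-645780, Thm. 1.3 (p. 3)] -/
def BennettYazdaniTwoPower : Prop :=
  ∀ k : ℕ, ∃ C : ℕ, ∀ (W : WeierstrassCurve ℚ) [W.IsElliptic] (p : ℕ), p.Prime → C ≤ p →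
    W.conductorNorm ℤ = 2 ^ k * p → (∃ n : ℕ, 1 < n ∧ HasRationalIsogenyOfDegree W n) →
    (W.minimalDiscriminantNorm ℤ).factorization p ≤ 6

/-- **H6 (S, PROVED modulo H1, H1′, H4, H5) — the modular local rung `R(2^k·p)`, `k ≤ 4`:** for `p ≥ p₀(k)` every
class curve of conductor `2^k·p` has `n_p ∈ {1,3,5}`, i.e. `LocalIndexSzpiroAt (2^k) 5`.  (`n_p` is odd by H2; if
`n_p > 1` its least prime factor `ℓ` is odd, H4 gives a rational `ℓ`-isogeny, H5 gives `n_p ≤ 6`.) -/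
theorem localIndexSzpiroAt_two_pow (hPL : MultParityLaw) (hOM : OddPrimeMeetsConductor)
    (hR : RibetLevelLoweringTwoPower) (hBY : BennettYazdaniTwoPower) {k : ℕ} (hk : k ≤ 4) :
    LocalIndexSzpiroAt (2 ^ k) 5 := by
  obtain ⟨C, hC⟩ := hBY k
  refine ⟨max C 3, ?_⟩
  intro W _ K _ _ hirr hK hθ _ p hp hp0 _ hN
  have hp3 : 3 ≤ p := le_trans (le_max_right _ _) hp0
  have hp2 : p ≠ 2 := by omega
  have hCp : C ≤ p := le_trans (le_max_left _ _) hp0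
  have hodd := odd_factorization_of_conductorNorm_eq_two_pow_mul hPL hOM W K hirr hK hθ hp hp2 hN
  obtain ⟨n, hn⟩ : ∃ n, (W.minimalDiscriminantNorm ℤ).factorization p = n := ⟨_, rfl⟩
  rw [hn] at hodd ⊢
  by_cases h1 : n ≤ 1
  · omega
  · have hn2 : 2 ≤ n := by omega
    have hℓ : n.minFac.Prime := Nat.minFac_prime (by omega)
    have hℓdvd : n.minFac ∣ n := Nat.minFac_dvd n
    have hℓ2 : n.minFac ≠ 2 := by
      intro h2
      rw [h2] at hℓdvd
      exact (Nat.not_even_iff_odd.mpr hodd) (even_iff_two_dvd.mpr hℓdvd)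
    have hiso := hR W k p n.minFac hk hp hp2 hℓ hℓ2 hN (by rw [hn]; exact hℓdvd)
    have h6 := hC W p hp hCp hN ⟨n.minFac, hℓ.one_lt, hiso⟩
    rw [hn] at h6
    obtain ⟨m, hm⟩ := hodd
    omega

/-- **H7 (S, PROVED from the vendored fact) — the BC5 rung in the local currency:** `LocalIndexSzpiroAt 1 5` is
Mestre–Oesterlé's `Δ_min ∣ N⁵` for prime conductor (tree-named `mestreOesterle_factorization_le_five`; for CLASS
curves its content is exactly the `k = 0` case of H6: parity + Ribet to level 1 + isogeny ⇒ size).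
[cite: MestreOesterle1989, §5 Théorème 2] -/
theorem localIndexSzpiroAt_one (hMO : mestreOesterle_factorization_le_five) : LocalIndexSzpiroAt 1 5 := by
  refine ⟨0, ?_⟩
  intro W _ K _ _ _ _ _ _ p hp _ _ hN
  rw [one_mul] at hN
  have hp' : (W.conductorNorm ℤ).Prime := by rw [hN]; exact hp
  have h := hMO W hp'
  rw [hN] at h
  exact h

/-! ## §3 Why the rung is LOCAL: at `N = 2p` the stub is a statement about the 2-tower -/

/-- **H8 (def).** The 2-tower bound on (real) class curves of conductor `2p`: `2^{n_2} ≤ C·p^κ`.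
Given H6 (`n_p ≤ 5`) and H9 (`|d_K| ∈ {p,2p,4p,8p}`): `TwoTowerBoundAt2p (2+ε) ⟹ stub on {N = 2p} ⟹
TwoTowerBoundAt2p (6+ε)`; Szpiro `6+ε` itself on `{N = 2p}` sits between `κ = 1+ε` and `κ = 5+ε`.  Known ceiling:
`n_2·log 2 ≤ log Δ_min ≤ (½+o(1))(N + 7d(N²)) log N`, i.e. `n_2 ≪ p log p` (tree-named `pasten_thm_7_5_explicit`);
no level-lowering handle on `n_2` at level `2p` for `p ∉ {3,5,7,13}` (`S₂(Γ₀(p)) ≠ 0`; the level-raising condition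
`a₂(g)² ≡ 9 (mod λ)` only bounds the odd SUPPORT of `n_2`, exponentially in `p`). [cite: PastenShimura2024, Thm 7.5] -/
def TwoTowerBoundAt2p (κ : ℝ) : Prop :=
  ∃ C : ℝ, ∀ (W : WeierstrassCurve ℚ) [W.IsElliptic] (K : Type) [Field K] [NumberField K],
    Irreducible W.twoTorsionPolynomial.toPoly → Module.finrank ℚ K = 3 →
    (∃ θ : K, aeval θ W.twoTorsionPolynomial.toPoly = 0) → 0 < NumberField.discr K →
    ∀ p : ℕ, p.Prime → p ≠ 2 → W.conductorNorm ℤ = 2 * p →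
      (2 : ℝ) ^ (W.minimalDiscriminantNorm ℤ).factorization 2 ≤ C * (p : ℝ) ^ κ

/-- **H8b (S, PROVED from the landed `resolventDiscBounds_proof : |d_K| ≤ 1944·N²`).**  The stub forces
`2^{n_2} ≤ C·p^{8+ε}` at conductor `2p` (`2^{n_2} ≤ Δ_min ≤ C|d_K|N^{6+ε} ≤ C·1944·(2p)^{8+ε}`); with k3 G8 H3
(`|d_K| ∣ 216N`) the exponent drops to `7+ε`, with H9 to `6+ε` — in every form a logarithmic bound `n_2 ≤ κ log₂ p + O(1)`
on the 2-tower, which no input of §1–§2 touches. -/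
theorem twoTowerBoundAt2p_of_stub (h : StubRealCubic) {ε : ℝ} (hε : 0 < ε) : TwoTowerBoundAt2p (8 + ε) := by
  obtain ⟨C, hC⟩ := h ε hε
  refine ⟨max C 0 * 1944 * (2 : ℝ) ^ (8 + ε), ?_⟩
  intro W _ K _ _ hirr hK hθ hd p hp hp2 hN
  have hΔ0 : 0 < W.minimalDiscriminantNorm ℤ := W.minimalDiscriminantNorm_pos_holds
  have h2v : 2 ^ (W.minimalDiscriminantNorm ℤ).factorization 2 ≤ W.minimalDiscriminantNorm ℤ :=
    Nat.ordProj_le 2 hΔ0.ne'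
  have h2vR : (2 : ℝ) ^ (W.minimalDiscriminantNorm ℤ).factorization 2 ≤ (W.minimalDiscriminantNorm ℤ : ℝ) := by
    exact_mod_cast h2v
  have hdK := (Summit.ABC.ABC.Theorems.resolventDiscBounds_proof).1 W K hirr hK hθ
  have hb := hC W K hirr hK hθ hd
  have hNr : (W.conductorNorm ℤ : ℝ) = 2 * (p : ℝ) := by exact_mod_cast hN
  have hNpos : (0 : ℝ) < (W.conductorNorm ℤ : ℝ) := by exact_mod_cast W.conductorNorm_pos_holds
  have hp0 : (0 : ℝ) < (p : ℝ) := by exact_mod_cast hp.pos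
  have hNκ : 0 ≤ (W.conductorNorm ℤ : ℝ) ^ (6 + ε) := Real.rpow_nonneg hNpos.le _
  have step1 : (W.minimalDiscriminantNorm ℤ : ℝ) ≤
      max C 0 * (1944 * (W.conductorNorm ℤ : ℝ) ^ (2 : ℕ)) * (W.conductorNorm ℤ : ℝ) ^ (6 + ε) := by
    calc (W.minimalDiscriminantNorm ℤ : ℝ)
        ≤ C * |(NumberField.discr K : ℝ)| * (W.conductorNorm ℤ : ℝ) ^ (6 + ε) := hb
      _ ≤ max C 0 * |(NumberField.discr K : ℝ)| * (W.conductorNorm ℤ : ℝ) ^ (6 + ε) :=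
          mul_le_mul_of_nonneg_right (mul_le_mul_of_nonneg_right (le_max_left _ _) (abs_nonneg _)) hNκ
      _ ≤ max C 0 * (1944 * (W.conductorNorm ℤ : ℝ) ^ (2 : ℕ)) * (W.conductorNorm ℤ : ℝ) ^ (6 + ε) :=
          mul_le_mul_of_nonneg_right (mul_le_mul_of_nonneg_left hdK (le_max_right _ _)) hNκ
  have hexp : ((2 : ℕ) : ℝ) + (6 + ε) = 8 + ε := by push_cast; ring
  have hpow : (W.conductorNorm ℤ : ℝ) ^ (2 : ℕ) * (W.conductorNorm ℤ : ℝ) ^ (6 + ε) =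
      (2 : ℝ) ^ (8 + ε) * (p : ℝ) ^ (8 + ε) := by
    rw [← Real.rpow_natCast _ 2, ← Real.rpow_add hNpos, hexp, hNr, Real.mul_rpow (by norm_num) hp0.le]
  calc (2 : ℝ) ^ (W.minimalDiscriminantNorm ℤ).factorization 2 ≤ (W.minimalDiscriminantNorm ℤ : ℝ) := h2vR
    _ ≤ max C 0 * (1944 * (W.conductorNorm ℤ : ℝ) ^ (2 : ℕ)) * (W.conductorNorm ℤ : ℝ) ^ (6 + ε) := step1
    _ = max C 0 * 1944 * ((W.conductorNorm ℤ : ℝ) ^ (2 : ℕ) * (W.conductorNorm ℤ : ℝ) ^ (6 + ε)) := by ring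
    _ = max C 0 * 1944 * (2 : ℝ) ^ (8 + ε) * (p : ℝ) ^ (8 + ε) := by rw [hpow]; ring

/-- **H9 (M, `sorry`; inputs: H1 gives `v_p(d_K) = 1`; `not_dvd_discr_divisionField_two` + `NumberField.discr_dvd_discr`
+ `exists_ringHom_divisionField_two` give `v_q(d_K) = 0` at odd `q ≠ p`; tree cap `padicValNat_two_discr_le_three`).**
At conductor `2^k·p` the allowance is EXACTLY one storey of the `p`-tower up to a factor `≤ 8`: `|d_K| = 2^a·p`, `a ≤ 3`.
Census j345195 (this page) checks it on the box. -/
theorem natAbs_discr_eq_two_pow_mul (hPL : MultParityLaw)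
    (W : WeierstrassCurve ℚ) [W.IsElliptic] (K : Type) [Field K] [NumberField K]
    (hirr : Irreducible W.twoTorsionPolynomial.toPoly) (hK : Module.finrank ℚ K = 3)
    (hθ : ∃ θ : K, aeval θ W.twoTorsionPolynomial.toPoly = 0)
    {p k : ℕ} (hp : p.Prime) (hp2 : p ≠ 2) (hN : W.conductorNorm ℤ = 2 ^ k * p) :
    ∃ a : ℕ, a ≤ 3 ∧ (NumberField.discr K).natAbs = 2 ^ a * p := by
  sorry

/-- **Summary glue (S, PROVED): what `R(2p)` does NOT give.**  If the stub held, the 2-towers at conductor `2p`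
would be logarithmic (H8b); H6 bounds only the `p`-tower.  Typed: `StubRealCubic → TwoTowerBoundAt2p (8+ε)` for
every `ε > 0`, while `LocalIndexSzpiroAt 2 5` mentions `n_2` nowhere. -/
theorem stub_controls_two_tower (h : StubRealCubic) : ∀ ε : ℝ, 0 < ε → TwoTowerBoundAt2p (8 + ε) :=
  fun _ hε => twoTowerBoundAt2p_of_stub h hε

end Summit.ABC.ABC.Cruxes.IndexSzpiro.StubIdeas3G11

end
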